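import Literature.MathematicalPhysics.QuantumFieldTheory.Balaban1983to89.Beta.PlaquetteVertex2

/-!
# The lattice `(2,2)`-jet in colour coordinates: position-pair normal form of `τ(P22(p_{μν}(x)))` and the `(v ⊗ v)`-bilinear form
# with explicit `B`-quadratic colour matrix families (`mSym`, `mPair`) at fixed background

HONEST FRAMING (cell `pub-balaban`, β sub-cell, lineage an3; verbatim): discharging `BetaPertH` makes Bałaban's UV stability
UNCONDITIONAL — a real constructive-QFT result; it is NOT the continuum limit and NOT the Clay problem.  This file discharges NOTHING
of `BetaPertH`: it is lattice-level bookkeeping — the colour-coordinate read-off of the `(W², B²)` Taylor jet of the Wilson plaquette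
sum (`Beta.PlaquetteVertex2`), the an3-owned input of the SECOND-ORDER background-vertex family (the `W`-slot of a one-step jet datum).
ABSOLUTE RULE of the cell: no internally minted statement enters as a cited fact; every declaration below is a definition or is
kernel-proved here from the single import; NOTHING is cited.  The manuscripts under audit are not citable for their disputed steps
and are not cited here.

SETTING.  As in `Beta.PlaquetteVertex2` with the scalars fixed to `𝕜 = ℝ` (the coordinate sections of `Beta.PlaquetteVertex` are
real): a lattice `Λ` (an additive commutative group), directions `D`, unit steps `e : D → Λ`, link variables `U_b = e^{W_b} e^{B_b}`
with a fluctuation letter field `W` and a background letter field `B : Λ → D → 𝔸` in a real normed algebra `𝔸`, the plaquette word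
`plaqWord e W B x μ ν` (letters `W₁ = W_μ(x)`, `W₂ = W_ν(x+e_μ)`, `W₃ = W_μ(x+e_ν)`, `W₄ = W_ν(x)`, `B` likewise,
`F = lcurl e B x μ ν = B₁ + B₂ − B₃ − B₄`), its bidegree-`(2,2)` component `P22 ℝ` and the per-plaquette four-form normal form
`PlaquetteVertex2.trace_P22_plaqWord` (`transport₂ + seagull + spinTransport + contact`).  COLOUR COORDINATES
(`PlaquetteVertex.field`): `W_k(x) = Σ_a v(x,(a,k)) • t_a` for a letter family `t : C → 𝔸` and a real fluctuation vector `v`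
indexed by `Λ × (C × D)`.

CONTENT (all [folklore]: definitions, finite sums and polynomial identities in an associative algebra).
* §1 POSITIONS.  The four bond positions `site e x μ ν : Fin 4 → Λ × D` of `p_{μν}(x)` in contour order, the orientation signs
  `sgn = (1, 1, −1, −1)`, the letters `wAt` at the positions, the ACCUMULATED BACKGROUNDS `bacc = (0, B₁, F + B₄, F)` and ACCUMULATED
  COMMUTATORS `cacc = (0, 0, c₃, c₄)` (`c₃ = [B₁,F] + [B₁,B₄] − [B₂,B₃]`, `c₄ = [B₁+B₄, F] + [B₁,B₄] − [B₂,B₃]`, the arguments of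
  `PlaquetteVertex2.twist₂W_regroup`), the `B`-only quadratic letter `quadB = ½(F² + plaqPairs_B)` (`quad_bpart_plaqWord`), and the
  position sums: `lcurl W = Σ_i s_i W_i` (`lcurl_eq_sum`), `twistW = Σ_i s_i [β_i, W_i]` (`twistW_eq_sum`),
  `twist₂W = Σ_i s_i ad₂(β_i, c_i)(W_i)` (`twist₂W_eq_sum`), `plaqPairs_W = Σ_{i<j} s_i s_j [W_i, W_j]` (`plaqPairs_eq_ltSum`) and
  `ctwistW = Σ_{i<j} s_i s_j ([[β_i,W_i],W_j] + [W_i,[β_j,W_j]])` (`ctwistW_eq_ltSum`), with the explicit six-term sum `ltSum` over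
  position pairs `i < j` (`ltSum_eq_ite`).
* §2 THE POSITION-PAIR NORMAL FORM **`trace_P22_plaqWord_pos`**: for every tracial real-linear `τ`,
  `τ(P22(p_{μν}(x))) = Σ_{i,j} s_i s_j SYM_{ij} + Σ_{i<j} s_i s_j PAIR_{ij}` with
  `SYM_{ij} = ½τ([β_i,W_i][β_j,W_j]) + τ(W_i · ad₂(β_j,c_j)(W_j)) + ½τ(W_i W_j Q) + ½(τ(W_i [β_j,W_j] F) + τ([β_i,W_i] W_j F))` and
  `PAIR_{ij} = ½τ([W_i,W_j] Q) + ½τ(([[β_i,W_i],W_j] + [W_i,[β_j,W_j]]) F)` (`Q = quadB`): every term is a word BILINEAR in an ordered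
  pair of fluctuation letters with `B`-QUADRATIC coefficients (`β` linear, `c`, `Q` quadratic, `F` linear in the background letters).
* §3 COLOUR EXPANSION OF BILINEAR WORDS: the generic `trace_lin_mul_lin_mul` (`τ(L₁(Σ_a c_a t_a) · L₂(Σ_b d_b t_b) · R) =
  Σ_{a,b} c_a d_b τ(L₁ t_a · L₂ t_b · R)` for real-linear `L₁, L₂ : 𝔸 → 𝔸`), the commutator and second-order transport as linear maps
  (`brL`, `ad₂L`), and the word families of §2 (`word_brbr`, `word_ad₂`, `word_mulQ`, `word_mulQ_swap`, `word_brR`, `word_brL'`,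
  `word_brR_swap`, `word_brL_swap`, `word_pairQ`, `word_nested`).
* §4 THE COLOUR MATRIX FAMILIES AND THE `(v ⊗ v)` FORM.  `mSym τ t β β′ c′ F Q a b` and `mPair τ t β β′ F Q a b` (real, indexed by
  an ordered pair of colours, parameters: letters), `symBlock_expand` / `pairBlock_expand`, and **`trace_P22_plaqWord_field`**:
  `τ(P22(p_{μν}(x)))` at `W = field t v` equals
  `Σ_{i,j} Σ_{a,b} s_i s_j v_i(a) v_j(b) mSym(β_i, β_j, c_j, F, Q)_{ab} + Σ_{i<j} Σ_{a,b} s_i s_j v_i(a) v_j(b) mPair(β_i, β_j, F, Q)_{ab}`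
  (`v_i(a) = cv e v x μ ν i a = v(site_i.1, (a, site_i.2))`) — THE `(2,2)` PLAQUETTE 2-STENCIL AT FIXED BACKGROUND in colour
  coordinates; as ONE KERNEL `M22 i j a b = s_i s_j (mSym + [i<j]·mPair)`: `trace_P22_plaqWord_field_kernel`; summed over sites and
  ordered direction pairs: `jet22_field`.  At zero background every entry vanishes (`mSym_bzero`, `mPair_bzero`; the `(2,2)` component
  needs two background letters), and EVERY ENTRY IS A QUADRATIC FORM IN THE BACKGROUND LETTERS: `bacc_smul`, `cacc_smul`, `quadB_smul`,
  `mSym_smul`, `mPair_smul`, `M22_smul` (`M22` at `s•B` is `s²·M22` at `B`) — the input of the polarisation into background bond letters.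
* §5 Examples over `ℝ`.

NOT DONE HERE (successor nodes of the lineage): the polarisation of the `B`-quadratic entries in the four background letters (the
per-background-bond-pair families `m_t(Y, Y′)`, distinct-bond and contact cases) and the 2-stencil tables in the `PlaquetteStencilData`
format; the fluctuation-colour traces `Σ_a m_{aa}` (consumed by name from the cell's colour-trace leaves); the symmetric one-matrix
operator form; any value, any bound; gauge fixing / averaging; anything about `BetaPertH`.

GAPS record C-beta-an3-30 (HOME/GAPS.md of the cell).  All tags [folklore].
-/

noncomputable section

namespace Literature.MathematicalPhysics.QuantumFieldTheory.Balaban1983to89.Beta.PlaquetteVertex2Coords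

open Finset
open scoped BigOperators
open Literature.MathematicalPhysics.QuantumFieldTheory.Balaban1983to89.Beta.TransportVertices
open Literature.MathematicalPhysics.QuantumFieldTheory.Balaban1983to89.Beta.WilsonVertex
open Literature.MathematicalPhysics.QuantumFieldTheory.Balaban1983to89.Beta.WilsonVertex2
open Literature.MathematicalPhysics.QuantumFieldTheory.Balaban1983to89.Beta.PlaquetteVertex (lcurl lcurl_self lcurl_const plaqWord twistW
  twistW_regroup sum_wpart_plaqWord sum_bpart_plaqWord commSum_wpart_plaqWord field)
open Literature.MathematicalPhysics.QuantumFieldTheory.Balaban1983to89.Beta.PlaquetteVertex2 (twist₂W twist₂W_regroup qtwistW ctwistW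
  two_smul_qtwistW two_smul_quad_wpart_plaqWord two_smul_quad_bpart_plaqWord trace_P22_plaqWord jet22)
open Literature.MathematicalPhysics.QuantumFieldTheory.Balaban1983to89.Beta.SpinTable (br plaqPairs)

/-! ## §1 Positions, signs, accumulated backgrounds -/

section Positions

variable {𝔸 : Type*} [NormedRing 𝔸] [NormedAlgebra ℝ 𝔸]
variable {Λ : Type*} [AddCommGroup Λ] {D : Type*}

/-- THE FOUR BOND POSITIONS of the plaquette `p_{μν}(x)` in contour order: `(x,μ), (x+e_μ,ν), (x+e_ν,μ), (x,ν)`. [folklore] -/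
def site (e : D → Λ) (x : Λ) (μ ν : D) : Fin 4 → Λ × D := ![(x, μ), (x + e μ, ν), (x + e ν, μ), (x, ν)]

/-- THE ORIENTATION SIGNS of the four positions: `(1, 1, −1, −1)` (the last two links are traversed backwards). [folklore] -/
def sgn : Fin 4 → ℝ := ![1, 1, -1, -1]

/-- the letters of a bond field at the four positions: `(X₁, X₂, X₃, X₄) = (X_μ(x), X_ν(x+e_μ), X_μ(x+e_ν), X_ν(x))`. [folklore] -/
def wAt (e : D → Λ) (X : Λ → D → 𝔸) (x : Λ) (μ ν : D) : Fin 4 → 𝔸 := ![X x μ, X (x + e μ) ν, X (x + e ν) μ, X x ν]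

omit [NormedRing 𝔸] [NormedAlgebra ℝ 𝔸] in
/-- `wAt` is evaluation at `site`. [folklore] -/
theorem wAt_eq_site (e : D → Λ) (X : Λ → D → 𝔸) (x : Λ) (μ ν : D) (i : Fin 4) :
    wAt e X x μ ν i = X (site e x μ ν i).1 (site e x μ ν i).2 := by
  fin_cases i <;> rfl

/-- THE ACCUMULATED BACKGROUNDS seen by the fluctuation letter at each position (the background letters standing before it along the
contour, regrouped through `F = lcurl e B x μ ν` as in `PlaquetteVertex.twistW_regroup`): `(0, B₁, F + B₄, F)`. [folklore] -/
def bacc (e : D → Λ) (B : Λ → D → 𝔸) (x : Λ) (μ ν : D) : Fin 4 → 𝔸 :=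
  ![0, B x μ, lcurl e B x μ ν + B x ν, lcurl e B x μ ν]

/-- THE ACCUMULATED COMMUTATORS of the second-order transport at each position (the `c`-arguments of
`PlaquetteVertex2.twist₂W_regroup`): `(0, 0, [B₁,F] + [B₁,B₄] − [B₂,B₃], [B₁+B₄,F] + [B₁,B₄] − [B₂,B₃])`. [folklore] -/
def cacc (e : D → Λ) (B : Λ → D → 𝔸) (x : Λ) (μ ν : D) : Fin 4 → 𝔸 :=
  ![0, 0,
    br (B x μ) (lcurl e B x μ ν) + br (B x μ) (B x ν) - br (B (x + e μ) ν) (B (x + e ν) μ),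
    br (B x μ + B x ν) (lcurl e B x μ ν) + br (B x μ) (B x ν) - br (B (x + e μ) ν) (B (x + e ν) μ)]

/-- THE `B`-ONLY QUADRATIC LETTER `Q = ½(F² + plaqPairs(B₁, B₄, B₃, B₂))` of the plaquette (`= quad` of its background letters,
`quad_bpart_plaqWord`). [folklore] -/
def quadB (e : D → Λ) (B : Λ → D → 𝔸) (x : Λ) (μ ν : D) : 𝔸 :=
  (2 : ℝ)⁻¹ • (lcurl e B x μ ν * lcurl e B x μ ν + plaqPairs (B x μ) (B x ν) (B (x + e ν) μ) (B (x + e μ) ν))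

/-- THE SIX-TERM SUM over position pairs `i < j`. [folklore] -/
def ltSum {V : Type*} [AddCommMonoid V] (f : Fin 4 → Fin 4 → V) : V :=
  f 0 1 + f 0 2 + f 0 3 + f 1 2 + f 1 3 + f 2 3

/-- `ltSum` is the sum over ordered pairs restricted to `i < j`. [folklore] -/
theorem ltSum_eq_ite {V : Type*} [AddCommMonoid V] (f : Fin 4 → Fin 4 → V) :
    ltSum f = ∑ i, ∑ j, if i < j then f i j else 0 := by
  simp [ltSum, Fin.sum_univ_four]
  abel

variable (e : D → Λ) (W B : Λ → D → 𝔸) (x : Λ) (μ ν : D)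

/-- `quad` of the background letters of the plaquette is `quadB` (`PlaquetteVertex2.two_smul_quad_bpart_plaqWord`). [folklore] -/
theorem quad_bpart_plaqWord : quad ℝ (bpart (plaqWord e W B x μ ν)) = quadB e B x μ ν := by
  rw [quadB, ← two_smul_quad_bpart_plaqWord ℝ e W B x μ ν, smul_smul, inv_mul_cancel₀ (two_ne_zero' ℝ), one_smul]

/-- `quad` of the fluctuation letters through the curl and `plaqPairs`. [folklore] -/
theorem quad_wpart_plaqWord : quad ℝ (wpart (plaqWord e W B x μ ν)) =
    (2 : ℝ)⁻¹ • (lcurl e W x μ ν * lcurl e W x μ ν + plaqPairs (W x μ) (W x ν) (W (x + e ν) μ) (W (x + e μ) ν)) := by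
  rw [← two_smul_quad_wpart_plaqWord ℝ e W B x μ ν, smul_smul, inv_mul_cancel₀ (two_ne_zero' ℝ), one_smul]

/-- `qtwistW` through `twistW`, the curl and `ctwistW` (`PlaquetteVertex2.two_smul_qtwistW`). [folklore] -/
theorem qtwistW_eq_half : qtwistW ℝ e W B x μ ν =
    (2 : ℝ)⁻¹ • ((lcurl e W x μ ν * twistW e W B x μ ν + twistW e W B x μ ν * lcurl e W x μ ν) + ctwistW e W B x μ ν) := by
  rw [← two_smul_qtwistW ℝ e W B x μ ν, smul_smul, inv_mul_cancel₀ (two_ne_zero' ℝ), one_smul]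

/-- THE CURL AS A POSITION SUM: `lcurl W = Σ_i s_i W_i`. [folklore] -/
theorem lcurl_eq_sum : lcurl e W x μ ν = ∑ i, sgn i • wAt e W x μ ν i := by
  simp [Fin.sum_univ_four, sgn, wAt, lcurl]
  abel

/-- THE FIRST-ORDER TRANSPORT AS A POSITION SUM: `twistW = Σ_i s_i [β_i, W_i]` with the accumulated backgrounds `bacc`. [folklore] -/
theorem twistW_eq_sum : twistW e W B x μ ν = ∑ i, sgn i • br (bacc e B x μ ν i) (wAt e W x μ ν i) := by
  rw [twistW_regroup]
  simp [Fin.sum_univ_four, sgn, wAt, bacc, br]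
  noncomm_ring

/-- THE SECOND-ORDER TRANSPORT AS A POSITION SUM: `twist₂W = Σ_i s_i ad₂(β_i, c_i)(W_i)` with `bacc`, `cacc`. [folklore] -/
theorem twist₂W_eq_sum :
    twist₂W ℝ e W B x μ ν = ∑ i, sgn i • ad₂ ℝ (bacc e B x μ ν i) (cacc e B x μ ν i) (wAt e W x μ ν i) := by
  rw [twist₂W_regroup]
  simp [Fin.sum_univ_four, sgn, wAt, bacc, cacc]
  abel

/-- `plaqPairs` OF THE FLUCTUATION LETTERS AS A PAIR SUM: `Σ_{i<j} s_i s_j [W_i, W_j]`. [folklore] -/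
theorem plaqPairs_eq_ltSum : plaqPairs (W x μ) (W x ν) (W (x + e ν) μ) (W (x + e μ) ν) =
    ltSum fun i j => (sgn i * sgn j) • br (wAt e W x μ ν i) (wAt e W x μ ν j) := by
  simp [ltSum, sgn, wAt, plaqPairs]
  abel

/-- `ctwistW` AS A PAIR SUM: `Σ_{i<j} s_i s_j ([[β_i,W_i],W_j] + [W_i,[β_j,W_j]])`. [folklore] -/
theorem ctwistW_eq_ltSum : ctwistW e W B x μ ν =
    ltSum fun i j => (sgn i * sgn j) •
      (br (br (bacc e B x μ ν i) (wAt e W x μ ν i)) (wAt e W x μ ν j)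
        + br (wAt e W x μ ν i) (br (bacc e B x μ ν j) (wAt e W x μ ν j))) := by
  rw [ctwistW, twistW_regroup]
  simp [ltSum, sgn, wAt, bacc, br]
  noncomm_ring

/-- the lattice curl is real-homogeneous in the field. [folklore] -/
theorem lcurl_smul (s : ℝ) : lcurl e (s • B) x μ ν = s • lcurl e B x μ ν := by
  simp only [lcurl, Pi.smul_apply, smul_sub]

/-- the commutator is homogeneous of degree two under a common scaling of both letters. [folklore] -/
theorem br_smul_smul (s : ℝ) (X Y : 𝔸) : br (s • X) (s • Y) = (s * s) • br X Y := by
  simp only [br, smul_mul_assoc, mul_smul_comm, smul_sub, smul_smul]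

/-- THE ACCUMULATED BACKGROUNDS ARE `B`-LINEAR: `bacc e (s•B) = s • bacc e B`. [folklore] -/
theorem bacc_smul (s : ℝ) (i : Fin 4) : bacc e (s • B) x μ ν i = s • bacc e B x μ ν i := by
  fin_cases i <;> simp [bacc, lcurl_smul, smul_add]

/-- THE ACCUMULATED COMMUTATORS ARE `B`-QUADRATIC: `cacc e (s•B) = s² • cacc e B`. [folklore] -/
theorem cacc_smul (s : ℝ) (i : Fin 4) : cacc e (s • B) x μ ν i = (s * s) • cacc e B x μ ν i := by
  fin_cases i <;> simp [cacc, lcurl_smul, ← smul_add, br_smul_smul, smul_sub]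

/-- THE QUADRATIC LETTER IS `B`-QUADRATIC: `quadB e (s•B) = s² • quadB e B`. [folklore] -/
theorem quadB_smul (s : ℝ) : quadB e (s • B) x μ ν = (s * s) • quadB e B x μ ν := by
  simp only [quadB, lcurl_smul, Pi.smul_apply, plaqPairs, br_smul_smul, smul_mul_assoc, mul_smul_comm, smul_smul, ← smul_sub,
    ← smul_add]
  rw [mul_comm (s * s) 2⁻¹]

end Positions

/-! ## §2 The position-pair normal form of `τ(P22(p_{μν}(x)))` -/

section PositionPairs

variable {𝔸 : Type*} [NormedRing 𝔸] [NormedAlgebra ℝ 𝔸]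
variable {Λ : Type*} [AddCommGroup Λ] {D : Type*}

/-- **THE POSITION-PAIR NORMAL FORM.**  For a tracial real-linear `τ`,
`τ(P22(p_{μν}(x))) = Σ_{i,j} s_i s_j SYM_{ij} + Σ_{i<j} s_i s_j PAIR_{ij}` with
`SYM_{ij} = ½τ([β_i,W_i][β_j,W_j]) + τ(W_i · ad₂(β_j,c_j)(W_j)) + ½τ(W_i W_j Q) + ½(τ(W_i [β_j,W_j] F) + τ([β_i,W_i] W_j F))`,
`PAIR_{ij} = ½τ([W_i,W_j] Q) + ½τ(([[β_i,W_i],W_j] + [W_i,[β_j,W_j]]) F)`, `Q = quadB`, `F = lcurl e B x μ ν`, `β = bacc`, `c = cacc`: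
the seagull, second-order transport, contact and spin-transport words of `PlaquetteVertex2.trace_P22_plaqWord`, each BILINEAR in an
ordered pair of fluctuation letters with `B`-quadratic coefficients. [folklore] -/
theorem trace_P22_plaqWord_pos (τ : 𝔸 →ₗ[ℝ] ℝ) (hτ : ∀ a b : 𝔸, τ (a * b) = τ (b * a)) (e : D → Λ) (W B : Λ → D → 𝔸)
    (x : Λ) (μ ν : D) :
    τ (P22 ℝ (plaqWord e W B x μ ν)) =
      (∑ i, ∑ j, sgn i * sgn j *
          (2⁻¹ * τ (br (bacc e B x μ ν i) (wAt e W x μ ν i) * br (bacc e B x μ ν j) (wAt e W x μ ν j))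
            + τ (wAt e W x μ ν i * ad₂ ℝ (bacc e B x μ ν j) (cacc e B x μ ν j) (wAt e W x μ ν j))
            + 2⁻¹ * τ (wAt e W x μ ν i * wAt e W x μ ν j * quadB e B x μ ν)
            + 2⁻¹ * (τ (wAt e W x μ ν i * br (bacc e B x μ ν j) (wAt e W x μ ν j) * lcurl e B x μ ν)
                + τ (br (bacc e B x μ ν i) (wAt e W x μ ν i) * wAt e W x μ ν j * lcurl e B x μ ν))))
        + ltSum fun i j => sgn i * sgn j *
            (2⁻¹ * τ (br (wAt e W x μ ν i) (wAt e W x μ ν j) * quadB e B x μ ν)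
              + 2⁻¹ * τ ((br (br (bacc e B x μ ν i) (wAt e W x μ ν i)) (wAt e W x μ ν j)
                  + br (wAt e W x μ ν i) (br (bacc e B x μ ν j) (wAt e W x μ ν j))) * lcurl e B x μ ν)) := by
  rw [trace_P22_plaqWord ℝ τ hτ, qtwistW_eq_half, quad_wpart_plaqWord, quad_bpart_plaqWord, plaqPairs_eq_ltSum,
    ctwistW_eq_ltSum, lcurl_eq_sum e W x μ ν, twistW_eq_sum, twist₂W_eq_sum]
  simp only [Fin.sum_univ_four, ltSum, map_add, map_smul, map_neg, mul_add, add_mul,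
    smul_mul_assoc, smul_add, smul_eq_mul, sgn, Matrix.cons_val_zero, Matrix.cons_val_one, Matrix.head_cons,
    Matrix.cons_val_two, Matrix.cons_val_three, Matrix.tail_cons, one_smul, neg_smul, neg_mul, mul_neg, neg_neg, map_neg,
    mul_one, one_mul]
  ring

end PositionPairs

/-! ## §3 Colour expansion of bilinear words -/

section Words

variable {𝔸 : Type*} [NormedRing 𝔸] [NormedAlgebra ℝ 𝔸]
variable {C : Type*} [Fintype C]

/-- GENERIC COLOUR EXPANSION: for real-linear `L₁, L₂ : 𝔸 → 𝔸`, a letter `R` and coordinate vectors `c, d`,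
`τ(L₁(Σ_a c_a t_a) · L₂(Σ_b d_b t_b) · R) = Σ_a Σ_b c_a d_b τ(L₁ t_a · L₂ t_b · R)`. [folklore] -/
theorem trace_lin_mul_lin_mul (τ : 𝔸 →ₗ[ℝ] ℝ) (L₁ L₂ : 𝔸 →ₗ[ℝ] 𝔸) (R : 𝔸) (t : C → 𝔸) (c d : C → ℝ) :
    τ (L₁ (∑ a, c a • t a) * L₂ (∑ b, d b • t b) * R)
      = ∑ a, ∑ b, c a * d b * τ (L₁ (t a) * L₂ (t b) * R) := by
  simp only [map_sum, map_smul, Finset.sum_mul, Finset.mul_sum, smul_mul_assoc, mul_smul_comm, smul_eq_mul]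
  rw [Finset.sum_comm]
  refine Finset.sum_congr rfl fun a _ => Finset.sum_congr rfl fun b _ => ?_
  ring

/-- THE COMMUTATOR WITH A LETTER as a real-linear map: `brL β x = [β, x]`. [folklore] -/
def brL (β : 𝔸) : 𝔸 →ₗ[ℝ] 𝔸 := LinearMap.mulLeft ℝ β - LinearMap.mulRight ℝ β

/-- `brL β x = br β x`. [folklore] -/
@[simp] theorem brL_apply (β x : 𝔸) : brL β x = br β x := by
  simp [brL, br, LinearMap.mulLeft_apply, LinearMap.mulRight_apply]

/-- THE SECOND-ORDER TRANSPORT as a real-linear map: `ad₂L β c = ½ brL β ∘ brL β + ½ brL c`. [folklore] -/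
def ad₂L (β c : 𝔸) : 𝔸 →ₗ[ℝ] 𝔸 := (2 : ℝ)⁻¹ • ((brL β).comp (brL β)) + (2 : ℝ)⁻¹ • brL c

/-- `ad₂L β c x = ad₂ ℝ β c x`. [folklore] -/
@[simp] theorem ad₂L_apply (β c x : 𝔸) : ad₂L β c x = ad₂ ℝ β c x := by
  simp [ad₂L, ad₂]

variable (τ : 𝔸 →ₗ[ℝ] ℝ) (t : C → 𝔸) (c d : C → ℝ)

/-- seagull word: `τ([β, X][β′, Y])` at `X = Σ c_a t_a`, `Y = Σ d_b t_b`. [folklore] -/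
theorem word_brbr (β β' : 𝔸) :
    τ (br β (∑ a, c a • t a) * br β' (∑ b, d b • t b)) = ∑ a, ∑ b, c a * d b * τ (br β (t a) * br β' (t b)) := by
  simpa only [brL_apply, mul_one] using trace_lin_mul_lin_mul τ (brL β) (brL β') 1 t c d

/-- second-order transport word: `τ(X · ad₂(β′,c′)(Y))`. [folklore] -/
theorem word_ad₂ (β' c' : 𝔸) :
    τ ((∑ a, c a • t a) * ad₂ ℝ β' c' (∑ b, d b • t b)) = ∑ a, ∑ b, c a * d b * τ (t a * ad₂ ℝ β' c' (t b)) := by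
  simpa only [ad₂L_apply, LinearMap.id_coe, id_eq, mul_one] using trace_lin_mul_lin_mul τ LinearMap.id (ad₂L β' c') 1 t c d

/-- contact word: `τ(X Y Q)`. [folklore] -/
theorem word_mulQ (Q : 𝔸) :
    τ ((∑ a, c a • t a) * (∑ b, d b • t b) * Q) = ∑ a, ∑ b, c a * d b * τ (t a * t b * Q) := by
  simpa only [LinearMap.id_coe, id_eq] using trace_lin_mul_lin_mul τ LinearMap.id LinearMap.id Q t c d

/-- swapped contact word: `τ(Y X Q)`, indexed as `Σ_a Σ_b c_a d_b τ(t_b t_a Q)`. [folklore] -/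
theorem word_mulQ_swap (Q : 𝔸) :
    τ ((∑ b, d b • t b) * (∑ a, c a • t a) * Q) = ∑ a, ∑ b, c a * d b * τ (t b * t a * Q) := by
  rw [word_mulQ τ t d c Q, Finset.sum_comm]
  refine Finset.sum_congr rfl fun a _ => Finset.sum_congr rfl fun b _ => ?_
  ring

/-- spin word, commutator on the right letter: `τ(X [β′, Y] R)`. [folklore] -/
theorem word_brR (β' R : 𝔸) :
    τ ((∑ a, c a • t a) * br β' (∑ b, d b • t b) * R) = ∑ a, ∑ b, c a * d b * τ (t a * br β' (t b) * R) := by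
  simpa only [brL_apply, LinearMap.id_coe, id_eq] using trace_lin_mul_lin_mul τ LinearMap.id (brL β') R t c d

/-- spin word, commutator on the left letter: `τ([β, X] Y R)`. [folklore] -/
theorem word_brL' (β R : 𝔸) :
    τ (br β (∑ a, c a • t a) * (∑ b, d b • t b) * R) = ∑ a, ∑ b, c a * d b * τ (br β (t a) * t b * R) := by
  simpa only [brL_apply, LinearMap.id_coe, id_eq] using trace_lin_mul_lin_mul τ (brL β) LinearMap.id R t c d

/-- swapped spin word: `τ(Y [β, X] R)`, indexed as `Σ_a Σ_b c_a d_b τ(t_b [β, t_a] R)`. [folklore] -/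
theorem word_brR_swap (β R : 𝔸) :
    τ ((∑ b, d b • t b) * br β (∑ a, c a • t a) * R) = ∑ a, ∑ b, c a * d b * τ (t b * br β (t a) * R) := by
  rw [word_brR τ t d c β R, Finset.sum_comm]
  refine Finset.sum_congr rfl fun a _ => Finset.sum_congr rfl fun b _ => ?_
  ring

/-- swapped spin word: `τ([β′, Y] X R)`, indexed as `Σ_a Σ_b c_a d_b τ([β′, t_b] t_a R)`. [folklore] -/
theorem word_brL_swap (β' R : 𝔸) :
    τ (br β' (∑ b, d b • t b) * (∑ a, c a • t a) * R) = ∑ a, ∑ b, c a * d b * τ (br β' (t b) * t a * R) := by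
  rw [word_brL' τ t d c β' R, Finset.sum_comm]
  refine Finset.sum_congr rfl fun a _ => Finset.sum_congr rfl fun b _ => ?_
  ring

/-- contact pair word: `τ([X, Y] Q) = Σ_a Σ_b c_a d_b (τ(t_a t_b Q) − τ(t_b t_a Q))`. [folklore] -/
theorem word_pairQ (Q : 𝔸) :
    τ (br (∑ a, c a • t a) (∑ b, d b • t b) * Q) = ∑ a, ∑ b, c a * d b * (τ (t a * t b * Q) - τ (t b * t a * Q)) := by
  rw [br, sub_mul, map_sub, word_mulQ, word_mulQ_swap, ← Finset.sum_sub_distrib]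
  refine Finset.sum_congr rfl fun a _ => ?_
  rw [← Finset.sum_sub_distrib]
  refine Finset.sum_congr rfl fun b _ => ?_
  ring

/-- nested spin word: `τ(([[β,X],Y] + [X,[β′,Y]]) R)` expanded. [folklore] -/
theorem word_nested (β β' R : 𝔸) :
    τ ((br (br β (∑ a, c a • t a)) (∑ b, d b • t b) + br (∑ a, c a • t a) (br β' (∑ b, d b • t b))) * R)
      = ∑ a, ∑ b, c a * d b *
          ((τ (br β (t a) * t b * R) - τ (t b * br β (t a) * R)) + (τ (t a * br β' (t b) * R) - τ (br β' (t b) * t a * R))) := by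
  have h : (br (br β (∑ a, c a • t a)) (∑ b, d b • t b) + br (∑ a, c a • t a) (br β' (∑ b, d b • t b))) * R
      = (br β (∑ a, c a • t a) * (∑ b, d b • t b) * R - (∑ b, d b • t b) * br β (∑ a, c a • t a) * R)
          + ((∑ a, c a • t a) * br β' (∑ b, d b • t b) * R - br β' (∑ b, d b • t b) * (∑ a, c a • t a) * R) := by
    simp only [br]
    noncomm_ring
  rw [h, map_add, map_sub, map_sub, word_brL', word_brR_swap, word_brR, word_brL_swap]
  simp only [← Finset.sum_sub_distrib, ← Finset.sum_add_distrib]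
  refine Finset.sum_congr rfl fun a _ => Finset.sum_congr rfl fun b _ => ?_
  ring

end Words

/-! ## §4 The colour matrix families and the `(v ⊗ v)` form -/

section ColourMatrices

variable {𝔸 : Type*} [NormedRing 𝔸] [NormedAlgebra ℝ 𝔸] {C : Type*}

/-- THE SYMMETRIC-BLOCK COLOUR MATRIX FAMILY (present for every ordered position pair `(i, j)`): at accumulated backgrounds `β = β_i`,
`β′ = β_j`, accumulated commutator `c′ = c_j`, curvature letter `F` and quadratic letter `Q`,
`mSym a b = ½τ([β,t_a][β′,t_b]) + τ(t_a · ad₂(β′,c′)(t_b)) + ½τ(t_a t_b Q) + ½(τ(t_a [β′,t_b] F) + τ([β,t_a] t_b F))`: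
seagull + second-order transport + symmetric contact + symmetric spin-transport words; `B`-quadratic. [folklore] -/
def mSym (τ : 𝔸 →ₗ[ℝ] ℝ) (t : C → 𝔸) (β β' c' F Q : 𝔸) (a b : C) : ℝ :=
  2⁻¹ * τ (br β (t a) * br β' (t b)) + τ (t a * ad₂ ℝ β' c' (t b)) + 2⁻¹ * τ (t a * t b * Q)
    + 2⁻¹ * (τ (t a * br β' (t b) * F) + τ (br β (t a) * t b * F))

/-- THE PAIR-BLOCK COLOUR MATRIX FAMILY (present only for position pairs `i < j`):
`mPair a b = ½(τ(t_a t_b Q) − τ(t_b t_a Q)) + ½((τ([β,t_a] t_b F) − τ(t_b [β,t_a] F)) + (τ(t_a [β′,t_b] F) − τ([β′,t_b] t_a F)))`: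
the contact-pair and nested spin-transport words; `B`-quadratic. [folklore] -/
def mPair (τ : 𝔸 →ₗ[ℝ] ℝ) (t : C → 𝔸) (β β' F Q : 𝔸) (a b : C) : ℝ :=
  2⁻¹ * (τ (t a * t b * Q) - τ (t b * t a * Q))
    + 2⁻¹ * ((τ (br β (t a) * t b * F) - τ (t b * br β (t a) * F)) + (τ (t a * br β' (t b) * F) - τ (br β' (t b) * t a * F)))

/-- at zero background letters every `mSym` entry vanishes. [folklore] -/
theorem mSym_bzero (τ : 𝔸 →ₗ[ℝ] ℝ) (t : C → 𝔸) (a b : C) : mSym τ t 0 0 0 0 0 a b = 0 := by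
  simp [mSym, br]

/-- at zero background letters every `mPair` entry vanishes. [folklore] -/
theorem mPair_bzero (τ : 𝔸 →ₗ[ℝ] ℝ) (t : C → 𝔸) (a b : C) : mPair τ t 0 0 0 0 a b = 0 := by
  simp [mPair, br]

/-- `[s•β, y] = s•[β, y]`. [folklore] -/
theorem br_smul_left (s : ℝ) (X Y : 𝔸) : br (s • X) Y = s • br X Y := by
  simp only [br, smul_mul_assoc, mul_smul_comm, smul_sub]

/-- `[β, s•y] = s•[β, y]`. [folklore] -/
theorem br_smul_right (s : ℝ) (X Y : 𝔸) : br X (s • Y) = s • br X Y := by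
  simp only [br, smul_mul_assoc, mul_smul_comm, smul_sub]

/-- `ad₂(s•β, s²•c) = s² • ad₂(β, c)`. [folklore] -/
theorem ad₂_smul_acc (s : ℝ) (β c y : 𝔸) : ad₂ ℝ (s • β) ((s * s) • c) y = (s * s) • ad₂ ℝ β c y := by
  simp only [ad₂, br_smul_left, br_smul_right, smul_add, smul_smul]
  module

/-- **`mSym` IS `B`-QUADRATIC**: scaling the background letters (`β, β′, F` by `s`; `c′, Q` by `s²`) scales every entry by `s²` —
each entry is a quadratic form in the background letters (its polarisation is the successor node). [folklore] -/
theorem mSym_smul (τ : 𝔸 →ₗ[ℝ] ℝ) (t : C → 𝔸) (s : ℝ) (β β' c' F Q : 𝔸) (a b : C) :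
    mSym τ t (s • β) (s • β') ((s * s) • c') (s • F) ((s * s) • Q) a b = s * s * mSym τ t β β' c' F Q a b := by
  simp only [mSym, br_smul_left, ad₂_smul_acc, smul_mul_assoc, mul_smul_comm, smul_smul, map_smul, smul_eq_mul]
  ring

/-- **`mPair` IS `B`-QUADRATIC** in the same sense. [folklore] -/
theorem mPair_smul (τ : 𝔸 →ₗ[ℝ] ℝ) (t : C → 𝔸) (s : ℝ) (β β' F Q : 𝔸) (a b : C) :
    mPair τ t (s • β) (s • β') (s • F) ((s * s) • Q) a b = s * s * mPair τ t β β' F Q a b := by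
  simp only [mPair, br_smul_left, smul_mul_assoc, mul_smul_comm, smul_smul, map_smul, smul_eq_mul]
  ring

end ColourMatrices

section Colour

variable {𝔸 : Type*} [NormedRing 𝔸] [NormedAlgebra ℝ 𝔸]
variable {Λ : Type*} [AddCommGroup Λ] {C : Type*} [Fintype C] {D : Type*}

/-- THE SYMMETRIC BLOCK IN COLOUR COORDINATES: `s · SYM(X, Y) = Σ_a Σ_b s c_a d_b mSym_{ab}` at `X = Σ c_a t_a`, `Y = Σ d_b t_b`.
[folklore] -/
theorem symBlock_expand (τ : 𝔸 →ₗ[ℝ] ℝ) (t : C → 𝔸) (β β' c' F Q : 𝔸) (c d : C → ℝ) (s : ℝ) :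
    s * (2⁻¹ * τ (br β (∑ a, c a • t a) * br β' (∑ b, d b • t b))
          + τ ((∑ a, c a • t a) * ad₂ ℝ β' c' (∑ b, d b • t b))
          + 2⁻¹ * τ ((∑ a, c a • t a) * (∑ b, d b • t b) * Q)
          + 2⁻¹ * (τ ((∑ a, c a • t a) * br β' (∑ b, d b • t b) * F) + τ (br β (∑ a, c a • t a) * (∑ b, d b • t b) * F)))
      = ∑ a, ∑ b, s * (c a * d b) * mSym τ t β β' c' F Q a b := by
  rw [word_brbr, word_ad₂, word_mulQ, word_brR, word_brL']
  simp only [mSym, mul_add, Finset.mul_sum, ← Finset.sum_add_distrib]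
  refine Finset.sum_congr rfl fun a _ => Finset.sum_congr rfl fun b _ => ?_
  ring

/-- THE PAIR BLOCK IN COLOUR COORDINATES: `s · PAIR(X, Y) = Σ_a Σ_b s c_a d_b mPair_{ab}`. [folklore] -/
theorem pairBlock_expand (τ : 𝔸 →ₗ[ℝ] ℝ) (t : C → 𝔸) (β β' F Q : 𝔸) (c d : C → ℝ) (s : ℝ) :
    s * (2⁻¹ * τ (br (∑ a, c a • t a) (∑ b, d b • t b) * Q)
          + 2⁻¹ * τ ((br (br β (∑ a, c a • t a)) (∑ b, d b • t b) + br (∑ a, c a • t a) (br β' (∑ b, d b • t b))) * F))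
      = ∑ a, ∑ b, s * (c a * d b) * mPair τ t β β' F Q a b := by
  rw [word_pairQ, word_nested]
  simp only [mPair, mul_add, Finset.mul_sum, ← Finset.sum_add_distrib]
  refine Finset.sum_congr rfl fun a _ => Finset.sum_congr rfl fun b _ => ?_
  ring

/-- THE COLOUR COORDINATES OF THE FLUCTUATION AT THE FOUR POSITIONS: `cv e v x μ ν i a = v(site_i.1, (a, site_i.2))`. [folklore] -/
def cv (e : D → Λ) (v : Λ × (C × D) → ℝ) (x : Λ) (μ ν : D) (i : Fin 4) (a : C) : ℝ :=
  v ((site e x μ ν i).1, (a, (site e x μ ν i).2))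

/-- the letters of the coordinate field at the positions are the coordinate combinations `Σ_a v_i(a) t_a`. [folklore] -/
theorem wAt_field (t : C → 𝔸) (e : D → Λ) (v : Λ × (C × D) → ℝ) (x : Λ) (μ ν : D) (i : Fin 4) :
    wAt e (field t v) x μ ν i = ∑ a, cv e v x μ ν i a • t a := by
  fin_cases i <;> rfl

/-- **THE `(2,2)` PLAQUETTE 2-STENCIL AT FIXED BACKGROUND, IN COLOUR COORDINATES.**  For a tracial real-linear `τ`, a letter family
`t : C → 𝔸` and a real fluctuation vector `v`, at `W = field t v`:
`τ(P22(p_{μν}(x))) = Σ_{i,j} Σ_{a,b} s_i s_j v_i(a) v_j(b) · mSym(β_i, β_j, c_j, F, Q)_{ab}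
                    + Σ_{i<j} Σ_{a,b} s_i s_j v_i(a) v_j(b) · mPair(β_i, β_j, F, Q)_{ab}`
with `β = bacc`, `c = cacc`, `F = lcurl e B x μ ν`, `Q = quadB e B x μ ν` — a `(v ⊗ v)`-bilinear form whose coefficients are explicit
`B`-QUADRATIC colour matrices. [folklore] -/
theorem trace_P22_plaqWord_field (τ : 𝔸 →ₗ[ℝ] ℝ) (hτ : ∀ a b : 𝔸, τ (a * b) = τ (b * a)) (t : C → 𝔸) (e : D → Λ)
    (v : Λ × (C × D) → ℝ) (B : Λ → D → 𝔸) (x : Λ) (μ ν : D) :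
    τ (P22 ℝ (plaqWord e (field t v) B x μ ν)) =
      (∑ i, ∑ j, ∑ a, ∑ b, sgn i * sgn j * (cv e v x μ ν i a * cv e v x μ ν j b)
          * mSym τ t (bacc e B x μ ν i) (bacc e B x μ ν j) (cacc e B x μ ν j) (lcurl e B x μ ν) (quadB e B x μ ν) a b)
        + ltSum fun i j => ∑ a, ∑ b, sgn i * sgn j * (cv e v x μ ν i a * cv e v x μ ν j b)
          * mPair τ t (bacc e B x μ ν i) (bacc e B x μ ν j) (lcurl e B x μ ν) (quadB e B x μ ν) a b := by
  rw [trace_P22_plaqWord_pos τ hτ]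
  simp only [wAt_field, symBlock_expand, pairBlock_expand]

/-- THE SINGLE KERNEL of the `(v ⊗ v)` form: `M22 i j a b = s_i s_j (mSym(β_i,β_j,c_j,F,Q)_{ab} + [i<j]·mPair(β_i,β_j,F,Q)_{ab})`.
[folklore] -/
def M22 (τ : 𝔸 →ₗ[ℝ] ℝ) (t : C → 𝔸) (e : D → Λ) (B : Λ → D → 𝔸) (x : Λ) (μ ν : D) (i j : Fin 4) (a b : C) : ℝ :=
  sgn i * sgn j *
    (mSym τ t (bacc e B x μ ν i) (bacc e B x μ ν j) (cacc e B x μ ν j) (lcurl e B x μ ν) (quadB e B x μ ν) a b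
      + if i < j then mPair τ t (bacc e B x μ ν i) (bacc e B x μ ν j) (lcurl e B x μ ν) (quadB e B x μ ν) a b else 0)

/-- THE `(2,2)` PLAQUETTE 2-STENCIL AS ONE KERNEL: `τ(P22(p_{μν}(x))) = Σ_{i,j} Σ_{a,b} v_i(a) v_j(b) M22_{ij,ab}` at `W = field t v`.
[folklore] -/
theorem trace_P22_plaqWord_field_kernel (τ : 𝔸 →ₗ[ℝ] ℝ) (hτ : ∀ a b : 𝔸, τ (a * b) = τ (b * a)) (t : C → 𝔸) (e : D → Λ)
    (v : Λ × (C × D) → ℝ) (B : Λ → D → 𝔸) (x : Λ) (μ ν : D) :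
    τ (P22 ℝ (plaqWord e (field t v) B x μ ν)) =
      ∑ i, ∑ j, ∑ a, ∑ b, cv e v x μ ν i a * cv e v x μ ν j b * M22 τ t e B x μ ν i j a b := by
  rw [trace_P22_plaqWord_field τ hτ, ltSum_eq_ite, ← Finset.sum_add_distrib]
  refine Finset.sum_congr rfl fun i _ => ?_
  rw [← Finset.sum_add_distrib]
  refine Finset.sum_congr rfl fun j _ => ?_
  by_cases h : i < j
  · simp only [M22, if_pos h, ← Finset.sum_add_distrib]
    refine Finset.sum_congr rfl fun a _ => Finset.sum_congr rfl fun b _ => ?_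
    ring
  · simp only [M22, if_neg h, add_zero]
    refine Finset.sum_congr rfl fun a _ => Finset.sum_congr rfl fun b _ => ?_
    ring

omit [Fintype C] in
/-- THE `(v ⊗ v)` FORM IS `B`-QUADRATIC ENTRYWISE: `M22` at `s•B` is `s²·M22` at `B`. [folklore] -/
theorem M22_smul (τ : 𝔸 →ₗ[ℝ] ℝ) (t : C → 𝔸) (e : D → Λ) (B : Λ → D → 𝔸) (x : Λ) (μ ν : D) (s : ℝ) (i j : Fin 4) (a b : C) :
    M22 τ t e (s • B) x μ ν i j a b = s * s * M22 τ t e B x μ ν i j a b := by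
  simp only [M22, bacc_smul, cacc_smul, lcurl_smul, quadB_smul, mSym_smul, mPair_smul]
  split_ifs <;> ring

/-- THE SUMMED `(2,2)`-JET IN COLOUR COORDINATES: `jet22 τ e (field t v) B` is the sum over sites and ordered direction pairs of the
per-plaquette `(v ⊗ v)` forms of `trace_P22_plaqWord_field`. [folklore] -/
theorem jet22_field [Fintype Λ] [Fintype D] (τ : 𝔸 →ₗ[ℝ] ℝ) (hτ : ∀ a b : 𝔸, τ (a * b) = τ (b * a)) (t : C → 𝔸) (e : D → Λ)
    (v : Λ × (C × D) → ℝ) (B : Λ → D → 𝔸) :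
    jet22 ℝ τ e (field t v) B =
      ∑ x, ∑ μ, ∑ ν,
        ((∑ i, ∑ j, ∑ a, ∑ b, sgn i * sgn j * (cv e v x μ ν i a * cv e v x μ ν j b)
            * mSym τ t (bacc e B x μ ν i) (bacc e B x μ ν j) (cacc e B x μ ν j) (lcurl e B x μ ν) (quadB e B x μ ν) a b)
          + ltSum fun i j => ∑ a, ∑ b, sgn i * sgn j * (cv e v x μ ν i a * cv e v x μ ν j b)
            * mPair τ t (bacc e B x μ ν i) (bacc e B x μ ν j) (lcurl e B x μ ν) (quadB e B x μ ν) a b) := by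
  simp only [jet22, trace_P22_plaqWord_field τ hτ]

end Colour

/-! ## §5 Examples -/

section Examples

/-- in a COMMUTATIVE algebra the pair block vanishes identically (no commutators, symmetric contact). [folklore] -/
example (τ : ℝ →ₗ[ℝ] ℝ) (t : Unit → ℝ) (β β' F Q : ℝ) (a b : Unit) : mPair τ t β β' F Q a b = 0 := by
  simp [mPair, br, mul_comm]

/-- in a COMMUTATIVE algebra only the symmetric contact word survives in `mSym`: `½τ(t_a t_b Q)`. [folklore] -/
example (τ : ℝ →ₗ[ℝ] ℝ) (t : Unit → ℝ) (β β' c' F Q : ℝ) (a b : Unit) : mSym τ t β β' c' F Q a b = 2⁻¹ * τ (t a * t b * Q) := by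
  simp [mSym, br, ad₂, mul_comm]

/-- `ltSum` of the constant family `1` is `6` (six position pairs). [folklore] -/
example : ltSum (fun _ _ => (1 : ℝ)) = 6 := by
  norm_num [ltSum]

/-- the signs multiply to `+1` on the pairs `(1,2)` and `(3,4)` and to `−1` on the four mixed pairs:
`Σ_{i<j} s_i s_j = 1 − 1 − 1 − 1 − 1 + 1 = −2`. [folklore] -/
example : ltSum (fun i j => sgn i * sgn j) = -2 := by
  simp [ltSum, sgn]; norm_num

/-- the signs sum to zero: `Σ_i s_i = 0` (the curl of a constant field vanishes). [folklore] -/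
example : ∑ i, sgn i = 0 := by
  simp [Fin.sum_univ_four, sgn]

end Examples

end Literature.MathematicalPhysics.QuantumFieldTheory.Balaban1983to89.Beta.PlaquetteVertex2Coords
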